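import Literature.MathematicalPhysics.QuantumFieldTheory.ConformalBootstrap3D.PointKernelK34v2Data
import Literature.MathematicalPhysics.QuantumFieldTheory.ConformalBootstrap3D.PointKernelParts

/-!
# K34v2 certificate, kernel part file P12: one-cell head segments 106, 107, 108 in level ranges

The head cells whose kernel evaluation exceeds one `decide` are one-cell segments of `hsegsK34v2`; each is
checked by `PCert.hPartSideOK` (side conditions) and `PCert.hPartOK` per level range `[n_lo, n_lo + count)`
against an integer claim, the claims summing to `≥ 0` (`PointKernel.partsOK`); soundness is
`PCert.hParts_sound` (`PointKernelParts`).  The part files `P1, P2, …` are mutually independent (each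
imports only the data file); the ranges of one cell may span several of them, and the per-cell
conclusions `hparts_i` / `hcell_i` of those cells are assembled in `PointKernelK34v2.lean`.
Estimated kernel time 219 s.
-/

set_option maxRecDepth 100000
set_option maxHeartbeats 0

namespace Literature.MathematicalPhysics.QuantumFieldTheory.ConformalBootstrap3D.PointKernelK34v2

open Literature.MathematicalPhysics.QuantumFieldTheory.ConformalBootstrap3D.PointKernel

/-- one-cell segment 106 (row 4, cell `[1283/256, 321/64]`, chord, `n_F = 42`,
2 level ranges): side conditions. [folklore] -/
theorem pside_106 : certK34v2.hPartSideOK (PCert.segAt hsegsK34v2 106) JHK34v2 = true := by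
  decide +kernel

/-- its level ranges `(n_lo, count, claim)`. [folklore] -/
def parts_106 : List (ℕ × ℕ × ℤ) := [(0, 33, -1555366466499325605296772884135799348), (33, 10, 1555366466499325605296772884135799348)]

/-- the ranges tile `[0, n_F]` and the claims sum to `≥ 0`. [folklore] -/
theorem pcov_106 : PointKernel.partsOK 42 parts_106 = true := by
  decide +kernel

/-- levels `[0, 33)` of segment 106: partial lower sum `≥` claim. [folklore] -/
theorem part_106_0 : certK34v2.hPartOK (PCert.segAt hsegsK34v2 106) JHK34v2 0 33 (-1555366466499325605296772884135799348) = true := by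
  decide +kernel

/-- levels `[33, 43)` of segment 106: partial lower sum `≥` claim. [folklore] -/
theorem part_106_1 : certK34v2.hPartOK (PCert.segAt hsegsK34v2 106) JHK34v2 33 10 (1555366466499325605296772884135799348) = true := by
  decide +kernel

/-- one-cell segment 107 (row 4, cell `[321/64, 1285/256]`, chord, `n_F = 42`,
2 level ranges): side conditions. [folklore] -/
theorem pside_107 : certK34v2.hPartSideOK (PCert.segAt hsegsK34v2 107) JHK34v2 = true := by
  decide +kernel

/-- its level ranges `(n_lo, count, claim)`. [folklore] -/
def parts_107 : List (ℕ × ℕ × ℤ) := [(0, 33, -1268611592823035310970611911796391524), (33, 10, 1268611592823035310970611911796391525)]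

/-- the ranges tile `[0, n_F]` and the claims sum to `≥ 0`. [folklore] -/
theorem pcov_107 : PointKernel.partsOK 42 parts_107 = true := by
  decide +kernel

/-- levels `[0, 33)` of segment 107: partial lower sum `≥` claim. [folklore] -/
theorem part_107_0 : certK34v2.hPartOK (PCert.segAt hsegsK34v2 107) JHK34v2 0 33 (-1268611592823035310970611911796391524) = true := by
  decide +kernel

/-- levels `[33, 43)` of segment 107: partial lower sum `≥` claim. [folklore] -/
theorem part_107_1 : certK34v2.hPartOK (PCert.segAt hsegsK34v2 107) JHK34v2 33 10 (1268611592823035310970611911796391525) = true := by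
  decide +kernel

/-- one-cell segment 108 (row 4, cell `[1285/256, 643/128]`, chord, `n_F = 34`,
2 level ranges): side conditions. [folklore] -/
theorem pside_108 : certK34v2.hPartSideOK (PCert.segAt hsegsK34v2 108) JHK34v2 = true := by
  decide +kernel

/-- its level ranges `(n_lo, count, claim)`. [folklore] -/
def parts_108 : List (ℕ × ℕ × ℤ) := [(0, 34, -187562246721392595547479260144729692), (34, 1, 187562246721392595547479260144729692)]

/-- the ranges tile `[0, n_F]` and the claims sum to `≥ 0`. [folklore] -/
theorem pcov_108 : PointKernel.partsOK 34 parts_108 = true := by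
  decide +kernel

end Literature.MathematicalPhysics.QuantumFieldTheory.ConformalBootstrap3D.PointKernelK34v2
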